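import Literature.Probability.LatticeModels.SRWReturnCounts
import Mathlib.Probability.Independence.InfinitePi
import Mathlib.Probability.ProductMeasure
import HarnessLib

/-!
# The simple random walk on `ℤ^d` as a probability space of infinite step sequences

Companion to `SRWStepSequences.lean` / `SRWReturnCounts.lean` (namespace
`Literature.Probability.LatticeModels.SRW`). The simple random walk is realised on the path space
`PathSpace d = ℕ → Dir d` with the product (`Measure.infinitePi`) of uniform step laws; `S ω j` is
the position after `j` steps. We prove the finite-dimensional facts behind second-moment
computations of self-intersections (Lawler 1991, §1.2–1.3; Spitzer 1976, §1), all folklore: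

* `stepLaw`, `pathLaw` (a probability measure for `d ≥ 1`, `[NeZero d]`), `S`, `incr`;
* `pathLaw_map_restrict` — the first `m` steps are uniform on `StepSeq d m`
  (`Measure.map_infinitePi_infinitePi_of_inj`, `Measure.infinitePi_eq_pi`, `pi_stepLaw_eq`);
* **`real_incr_eq`** — the law of an increment over any finite set `A` of step indices:
  `P(Σ_{l ∈ A} e_{ω_l} = x) = p_{|A|}(x)`; in particular `P(S_j - S_i = x) = p_{j-i}(x)`;
* **`real_inter_eq_of_dependsOn`** — events determined by disjoint sets of steps are
  independent (`ProbabilityTheory.iIndepFun_infinitePi`);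
* the self-intersection events `inter i j = {S_i = S_j}` and their pair probabilities in the four
  configurations: `real_inter` (`= p_{j-i}(0)`), `real_inter_inter_separated` (product),
  `real_inter_inter_chain` (`S_a = S_b = S_c`: `p_{b-a}(0) p_{c-b}(0)`), `real_inter_inter_nested`
  (`p_{l-k}(0) · p_{(k-i)+(j-l)}(0)`), `real_inter_inter_interlaced`
  (`Σ_y p_{k-i}(y) p_{j-k}(y) p_{l-j}(y)`).

Probabilities are stated through `Measure.real` (real-valued).
-/

noncomputable section

open MeasureTheory ProbabilityTheory Finset Set

namespace Literature.Probability.LatticeModels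

namespace SRW

variable {d : ℕ}

/-! ### The path space -/

/-- The uniform law on the `2d` directions (`d ≥ 1`). [folklore] -/
def stepLaw (d : ℕ) : Measure (Dir d) := ((2 * d : ℕ) : ENNReal)⁻¹ • Measure.count

/-- The uniform step law gives mass `(2d)⁻¹` to each direction. [folklore] -/
theorem stepLaw_singleton (v : Dir d) : stepLaw d {v} = ((2 * d : ℕ) : ENNReal)⁻¹ := by
  rw [stepLaw, Measure.smul_apply, Measure.count_singleton, smul_eq_mul, mul_one]

/-- The uniform step law is a probability measure (`d ≥ 1`). [folklore] -/
instance isProbabilityMeasure_stepLaw [NeZero d] : IsProbabilityMeasure (stepLaw d) := by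
  constructor
  rw [stepLaw, Measure.smul_apply, ← Finset.coe_univ, Measure.count_apply_finset, Finset.card_univ,
    card_dir, smul_eq_mul]
  have h : ((2 * d : ℕ) : ENNReal) ≠ 0 := by
    have := NeZero.ne d
    exact_mod_cast (by omega : 2 * d ≠ 0)
  exact ENNReal.inv_mul_cancel h (ENNReal.natCast_ne_top _)

/-- The path space of the simple random walk: infinite step sequences. [folklore] -/
abbrev PathSpace (d : ℕ) : Type := ℕ → Dir d

/-- The law of the simple random walk: i.i.d. uniform steps (`Measure.infinitePi`). [folklore] -/
def pathLaw (d : ℕ) [NeZero d] : Measure (PathSpace d) := Measure.infinitePi fun _ : ℕ => stepLaw d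

/-- The law of the walk is a probability measure. [folklore] -/
instance isProbabilityMeasure_pathLaw [NeZero d] : IsProbabilityMeasure (pathLaw d) := by
  unfold pathLaw; infer_instance

/-- The increment over a finite set of step indices, `Σ_{l ∈ A} e_{ω_l}`. [folklore] -/
def incr (ω : PathSpace d) (A : Finset ℕ) : Site d := ∑ l ∈ A, stepVec (ω l)

/-- The position after `j` steps, `S_j = Σ_{l<j} e_{ω_l}`. [folklore] -/
def S (ω : PathSpace d) (j : ℕ) : Site d := incr ω (Finset.range j)

/-- `S_0 = 0`. [folklore] -/
@[simp] theorem S_zero (ω : PathSpace d) : S ω 0 = 0 := by simp [S, incr]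

/-- Increments over disjoint index sets add. [folklore] -/
theorem incr_union (ω : PathSpace d) {A B : Finset ℕ} (h : Disjoint A B) :
    incr ω (A ∪ B) = incr ω A + incr ω B := by
  unfold incr; exact Finset.sum_union h

/-- `S_j - S_i` is the increment over `[i, j)`. [folklore] -/
theorem S_sub_S (ω : PathSpace d) {i j : ℕ} (hij : i ≤ j) : S ω j - S ω i = incr ω (Finset.Ico i j) := by
  unfold S
  rw [Finset.range_eq_Ico, Finset.range_eq_Ico, ← Finset.Ico_union_Ico_eq_Ico (Nat.zero_le i) hij,
    incr_union ω (Finset.Ico_disjoint_Ico_consecutive 0 i j)]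
  abel

/-- An increment over `A` is the endpoint of the `|A|`-step sequence read along `A`. [folklore] -/
theorem incr_eq_endpoint (ω : PathSpace d) (A : Finset ℕ) :
    incr ω A = endpoint (fun m : Fin A.card => ω (A.equivFin.symm m : ℕ)) := by
  unfold incr endpoint
  rw [← Finset.sum_coe_sort A, ← A.equivFin.symm.sum_comp]

/-- An increment over `A` lies in the box of radius `|A|`. [folklore] -/
theorem incr_mem_box (ω : PathSpace d) (A : Finset ℕ) : incr ω A ∈ box d A.card := by
  rw [incr_eq_endpoint]; exact endpoint_mem_box _

/-- The first `m` steps as a step sequence; its positions are the positions of the path.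
[folklore] -/
theorem pos_restrict (ω : PathSpace d) (m : ℕ) {i : ℕ} (hi : i ≤ m) :
    pos (fun l : Fin m => ω l) i = S ω i := by
  rw [pos_eq_sum_range _ hi, S, incr]
  refine Finset.sum_congr rfl fun l hl => ?_
  rw [dif_pos (lt_of_lt_of_le (Finset.mem_range.1 hl) hi)]

/-! ### Measurability: everything is determined by finitely many discrete coordinates -/

/-- A set of paths determined by the coordinates in a finite set `K` is measurable (the space of
`K`-coordinates is countable and discrete). [folklore] -/
theorem measurableSet_of_dependsOn {E : Set (PathSpace d)} {K : Finset ℕ}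
    (hE : DependsOn (· ∈ E) (K : Set ℕ)) : MeasurableSet E := by
  classical
  set πK : PathSpace d → (K → Dir d) := fun ω l => ω l with hπK
  have hπm : Measurable πK := measurable_pi_lambda _ fun l => measurable_pi_apply _
  have hEeq : E = πK ⁻¹' (πK '' E) := by
    ext ω
    constructor
    · intro h; exact ⟨ω, h, rfl⟩
    · rintro ⟨ω', hω', hπω⟩
      have : (ω' ∈ E) = (ω ∈ E) := hE fun l hl => by
        have := congrFun hπω ⟨l, hl⟩
        exact this
      rwa [← this]
  rw [hEeq]
  exact hπm (Set.Countable.measurableSet (Set.to_countable _))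

/-- The increment over `A` depends only on the coordinates in `A`. [folklore] -/
theorem dependsOn_incr (A : Finset ℕ) : DependsOn (fun ω : PathSpace d => incr ω A) (A : Set ℕ) := by
  intro ω ω' h
  unfold incr
  exact Finset.sum_congr rfl fun l hl => by rw [h l (Finset.mem_coe.2 hl)]

/-- Events `{incr A = x}` depend only on the coordinates in `A`. [folklore] -/
theorem dependsOn_incr_eq (A : Finset ℕ) (x : Site d) :
    DependsOn (· ∈ {ω : PathSpace d | incr ω A = x}) (A : Set ℕ) := by
  intro ω ω' h
  show (incr ω A = x) = (incr ω' A = x)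
  rw [show incr ω A = incr ω' A from dependsOn_incr A h]

/-- Dependence of an intersection of events on the union of the coordinate sets. [folklore] -/
theorem dependsOn_mem_inter {E F : Set (PathSpace d)} {I J : Set ℕ}
    (hE : DependsOn (· ∈ E) I) (hF : DependsOn (· ∈ F) J) : DependsOn (· ∈ E ∩ F) (I ∪ J) := by
  intro ω ω' h
  show (ω ∈ E ∧ ω ∈ F) = (ω' ∈ E ∧ ω' ∈ F)
  rw [show (ω ∈ E) = (ω' ∈ E) from hE fun i hi => h i (Set.mem_union_left _ hi),
    show (ω ∈ F) = (ω' ∈ F) from hF fun i hi => h i (Set.mem_union_right _ hi)]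

/-- Monotonicity of `DependsOn` in the coordinate set. [folklore] -/
theorem dependsOn_mono {α : Type*} {f : PathSpace d → α} {I J : Set ℕ} (h : DependsOn f I) (hIJ : I ⊆ J) :
    DependsOn f J := fun _ _ hω => h fun i hi => hω i (hIJ hi)

/-! ### Restriction to the first `m` steps -/

/-- The product of `m` uniform step laws is the uniform measure on `StepSeq d m`. [folklore] -/
theorem pi_stepLaw_eq [NeZero d] (m : ℕ) :
    Measure.pi (fun _ : Fin m => stepLaw d) = (((2 * d : ℕ) : ENNReal) ^ m)⁻¹ • Measure.count := by
  refine Measure.ext_of_singleton fun e => ?_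
  rw [← Set.univ_pi_singleton e, Measure.pi_pi]
  simp only [stepLaw_singleton, Finset.prod_const, Finset.card_univ, Fintype.card_fin,
    Set.univ_pi_singleton, Measure.smul_apply, Measure.count_singleton, smul_eq_mul, mul_one,
    ENNReal.inv_pow]

/-- **The first `m` steps are i.i.d. uniform**: the restriction map pushes `pathLaw` to the
uniform measure on `StepSeq d m`. [folklore] -/
theorem pathLaw_map_restrict [NeZero d] (m : ℕ) :
    (pathLaw d).map (fun ω (l : Fin m) => ω l) = (((2 * d : ℕ) : ENNReal) ^ m)⁻¹ • Measure.count := by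
  unfold pathLaw
  rw [Measure.map_infinitePi_infinitePi_of_inj (P := fun _ : ℕ => stepLaw d) (f := fun l : Fin m => (l : ℕ))
    Fin.val_injective, Measure.infinitePi_eq_pi, pi_stepLaw_eq]

/-- Probabilities of events on the first `m` steps are uniform counting probabilities.
[folklore] -/
theorem real_preimage_restrict [NeZero d] (m : ℕ) (T : Set (StepSeq d m)) :
    (pathLaw d).real ((fun ω (l : Fin m) => ω l) ⁻¹' T) =
      (T.toFinite.toFinset.card : ℝ) / (2 * d : ℝ) ^ m := by
  classical
  have hmeas : Measurable fun (ω : PathSpace d) (l : Fin m) => ω l :=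
    measurable_pi_lambda _ fun l => measurable_pi_apply _
  rw [measureReal_def, ← Measure.map_apply hmeas (Set.Countable.measurableSet T.to_countable),
    pathLaw_map_restrict, Measure.smul_apply, Measure.count_apply_finite _ T.toFinite, smul_eq_mul,
    ENNReal.toReal_mul, ENNReal.toReal_inv, ENNReal.toReal_pow, ENNReal.toReal_natCast,
    ENNReal.toReal_natCast]
  push_cast
  ring

/-! ### The law of an increment -/

/-- **Law of an increment**: `P(Σ_{l ∈ A} e_{ω_l} = x) = p_{|A|}(x)`. [folklore] -/
theorem real_incr_eq [NeZero d] (A : Finset ℕ) (x : Site d) :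
    (pathLaw d).real {ω | incr ω A = x} = prob d A.card x := by
  classical
  set m := A.card with hm
  set emb : Fin m → ℕ := fun i => (A.equivFin.symm i : ℕ) with hemb
  have hemb_inj : Function.Injective emb := by
    intro i j h
    exact A.equivFin.symm.injective (Subtype.ext h)
  have hmeas : Measurable fun (ω : PathSpace d) (i : Fin m) => ω (emb i) :=
    measurable_pi_lambda _ fun i => measurable_pi_apply _
  -- the increment is the endpoint of the pulled-back step sequence
  have hincr : ∀ ω : PathSpace d, incr ω A = endpoint (fun i : Fin m => ω (emb i)) := fun ω =>
    incr_eq_endpoint ω A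
  have hset : {ω : PathSpace d | incr ω A = x} =
      (fun (ω : PathSpace d) (i : Fin m) => ω (emb i)) ⁻¹' {e : StepSeq d m | endpoint e = x} := by
    ext ω; simp [hincr]
  rw [hset, measureReal_def, ← Measure.map_apply hmeas (Set.Countable.measurableSet (Set.to_countable _))]
  unfold pathLaw
  rw [Measure.map_infinitePi_infinitePi_of_inj (P := fun _ : ℕ => stepLaw d) hemb_inj,
    Measure.infinitePi_eq_pi, pi_stepLaw_eq, Measure.smul_apply, smul_eq_mul]
  have hfin : {e : StepSeq d m | endpoint e = x} = ↑(Finset.univ.filter fun e : StepSeq d m => endpoint e = x) := by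
    ext e; simp
  rw [hfin, Measure.count_apply_finset, ENNReal.toReal_mul, ENNReal.toReal_inv, ENNReal.toReal_pow,
    ENNReal.toReal_natCast, ENNReal.toReal_natCast, prob, count]
  push_cast
  ring

/-- **Law of `S_j - S_i`**: `P(S_j - S_i = x) = p_{j-i}(x)` for `i ≤ j`. [folklore] -/
theorem real_S_sub_S_eq [NeZero d] {i j : ℕ} (hij : i ≤ j) (x : Site d) :
    (pathLaw d).real {ω | S ω j - S ω i = x} = prob d (j - i) x := by
  have : {ω : PathSpace d | S ω j - S ω i = x} = {ω | incr ω (Finset.Ico i j) = x} := by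
    ext ω; rw [Set.mem_setOf_eq, Set.mem_setOf_eq, S_sub_S ω hij]
  rw [this, real_incr_eq, Nat.card_Ico]

/-! ### Independence of disjoint blocks of steps -/

/-- **Events determined by disjoint sets of steps are independent.** [folklore] -/
theorem real_inter_eq_of_dependsOn [NeZero d] {I J : Finset ℕ} (hIJ : Disjoint I J)
    {E F : Set (PathSpace d)} (hE : DependsOn (· ∈ E) (I : Set ℕ)) (hF : DependsOn (· ∈ F) (J : Set ℕ)) :
    (pathLaw d).real (E ∩ F) = (pathLaw d).real E * (pathLaw d).real F := by
  classical
  have hind : IndepFun (fun (ω : PathSpace d) (l : I) => ω l) (fun (ω : PathSpace d) (l : J) => ω l)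
      (pathLaw d) := by
    have h := iIndepFun_infinitePi (P := fun _ : ℕ => stepLaw d) (X := fun _ (v : Dir d) => v)
      (fun _ => measurable_id)
    exact h.indepFun_finset I J hIJ fun l => measurable_pi_apply l
  obtain ⟨ω₀⟩ : Nonempty (PathSpace d) := inferInstance
  set E' : Set (I → Dir d) := (fun z : I → Dir d => Function.updateFinset ω₀ I z) ⁻¹' E with hE'
  set F' : Set (J → Dir d) := (fun z : J → Dir d => Function.updateFinset ω₀ J z) ⁻¹' F with hF'
  have hEE : (fun (ω : PathSpace d) (l : I) => ω l) ⁻¹' E' = E := by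
    ext ω
    simp only [hE', Set.mem_preimage]
    have : (Function.updateFinset ω₀ I (fun l : I => ω l) ∈ E) = (ω ∈ E) :=
      hE fun l hl => by simp [Function.updateFinset, Finset.mem_coe.1 hl]
    exact this.to_iff
  have hFF : (fun (ω : PathSpace d) (l : J) => ω l) ⁻¹' F' = F := by
    ext ω
    simp only [hF', Set.mem_preimage]
    have : (Function.updateFinset ω₀ J (fun l : J => ω l) ∈ F) = (ω ∈ F) :=
      hF fun l hl => by simp [Function.updateFinset, Finset.mem_coe.1 hl]
    exact this.to_iff
  have h := hind.measure_inter_preimage_eq_mul E' F'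
    (Set.Countable.measurableSet (Set.to_countable _)) (Set.Countable.measurableSet (Set.to_countable _))
  rw [hEE, hFF] at h
  rw [measureReal_def, measureReal_def, measureReal_def, h, ENNReal.toReal_mul]

/-! ### Self-intersection events -/

/-- The self-intersection event `{S_i = S_j}`. [folklore] -/
def inter (i j : ℕ) : Set (PathSpace d) := {ω | S ω i = S ω j}

/-- `{S_i = S_j} = {S_j = S_i}`. [folklore] -/
theorem inter_comm (i j : ℕ) : (inter i j : Set (PathSpace d)) = inter j i := by
  ext ω; exact eq_comm

/-- `{S_i = S_j}` is the event that the increment over `[i,j)` vanishes (`i ≤ j`). [folklore] -/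
theorem inter_eq_incr {i j : ℕ} (hij : i ≤ j) :
    (inter i j : Set (PathSpace d)) = {ω | incr ω (Finset.Ico i j) = 0} := by
  ext ω
  rw [inter, Set.mem_setOf_eq, Set.mem_setOf_eq, ← S_sub_S ω hij, sub_eq_zero, eq_comm]

/-- `{S_i = S_j}` depends only on the steps in `[i,j)` (`i ≤ j`). [folklore] -/
theorem dependsOn_inter {i j : ℕ} (hij : i ≤ j) :
    DependsOn (· ∈ (inter i j : Set (PathSpace d))) (Finset.Ico i j : Set ℕ) := by
  rw [inter_eq_incr hij]
  exact dependsOn_incr_eq _ 0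

/-- `{S_i = S_j}` is measurable. [folklore] -/
theorem measurableSet_inter (i j : ℕ) : MeasurableSet (inter i j : Set (PathSpace d)) := by
  rcases le_total i j with h | h
  · exact measurableSet_of_dependsOn (dependsOn_inter h)
  · rw [inter_comm]; exact measurableSet_of_dependsOn (dependsOn_inter h)

/-- **`P(S_i = S_j) = p_{j-i}(0)`** (`i ≤ j`). [folklore] -/
theorem real_inter [NeZero d] {i j : ℕ} (hij : i ≤ j) :
    (pathLaw d).real (inter i j) = prob d (j - i) 0 := by
  rw [inter_eq_incr hij, real_incr_eq, Nat.card_Ico]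

/-- `P(S_i = S_j) ≥ 0`. [folklore] -/
theorem real_inter_nonneg [NeZero d] (i j : ℕ) : 0 ≤ (pathLaw d).real (inter i j : Set (PathSpace d)) :=
  measureReal_nonneg

/-- **Separated pairs are independent**: for `i ≤ j ≤ k ≤ l`,
`P(S_i = S_j, S_k = S_l) = P(S_i = S_j) P(S_k = S_l)`. [folklore] -/
theorem real_inter_inter_separated [NeZero d] {i j k l : ℕ} (hij : i ≤ j) (hjk : j ≤ k) (hkl : k ≤ l) :
    (pathLaw d).real (inter i j ∩ inter k l) = (pathLaw d).real (inter i j) * (pathLaw d).real (inter k l) :=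
  real_inter_eq_of_dependsOn ((Finset.Ico_disjoint_Ico_consecutive i j l).mono_right
    (Finset.Ico_subset_Ico hjk le_rfl)) (dependsOn_inter hij) (dependsOn_inter hkl)

/-- **Chains**: for `a ≤ b ≤ c`, `P(S_a = S_b, S_b = S_c) = p_{b-a}(0) p_{c-b}(0)`. [folklore] -/
theorem real_inter_inter_chain [NeZero d] {a b c : ℕ} (hab : a ≤ b) (hbc : b ≤ c) :
    (pathLaw d).real (inter a b ∩ inter b c) = prob d (b - a) 0 * prob d (c - b) 0 := by
  rw [real_inter_inter_separated hab le_rfl hbc, real_inter hab, real_inter hbc]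

/-- All the two-element intersections among `{S_a = S_b}`, `{S_a = S_c}`, `{S_b = S_c}` are the
chain event `{S_a = S_b} ∩ {S_b = S_c}`. [folklore] -/
theorem inter_ab_inter_ac (a b c : ℕ) :
    (inter a b ∩ inter a c : Set (PathSpace d)) = inter a b ∩ inter b c := by
  ext ω
  simp only [inter, Set.mem_inter_iff, Set.mem_setOf_eq]
  constructor
  · rintro ⟨h1, h2⟩; exact ⟨h1, h1 ▸ h2⟩
  · rintro ⟨h1, h2⟩; exact ⟨h1, h1.trans h2⟩

/-- … and `{S_a = S_c} ∩ {S_b = S_c} = {S_a = S_b} ∩ {S_b = S_c}`. [folklore] -/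
theorem inter_ac_inter_bc (a b c : ℕ) :
    (inter a c ∩ inter b c : Set (PathSpace d)) = inter a b ∩ inter b c := by
  ext ω
  simp only [inter, Set.mem_inter_iff, Set.mem_setOf_eq]
  constructor
  · rintro ⟨h1, h2⟩; exact ⟨h1.trans h2.symm, h2⟩
  · rintro ⟨h1, h2⟩; exact ⟨h1.trans h2, h2⟩

/-- **Nested pairs**: for `i ≤ k ≤ l ≤ j`,
`P(S_i = S_j, S_k = S_l) = p_{l-k}(0) · p_{(k-i)+(j-l)}(0)` (on `{S_k = S_l}` the outer increment is
the increment over `[i,k) ∪ [l,j)`, independent of the inner one). [folklore] -/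
theorem real_inter_inter_nested [NeZero d] {i k l j : ℕ} (hik : i ≤ k) (hkl : k ≤ l) (hlj : l ≤ j) :
    (pathLaw d).real (inter i j ∩ inter k l) = prob d (l - k) 0 * prob d (k - i + (j - l)) 0 := by
  have hdisj1 : Disjoint (Finset.Ico i k) (Finset.Ico l j) :=
    (Finset.Ico_disjoint_Ico_consecutive i k j).mono_right (Finset.Ico_subset_Ico hkl le_rfl)
  have hdisj : Disjoint (Finset.Ico k l) (Finset.Ico i k ∪ Finset.Ico l j) := by
    rw [Finset.disjoint_union_right]
    exact ⟨(Finset.Ico_disjoint_Ico_consecutive i k l).symm, Finset.Ico_disjoint_Ico_consecutive k l j⟩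
  -- decompose S_j - S_i
  have hdec : ∀ ω : PathSpace d, S ω j - S ω i =
      incr ω (Finset.Ico i k ∪ Finset.Ico l j) + incr ω (Finset.Ico k l) := by
    intro ω
    have h1 := S_sub_S ω hik; have h2 := S_sub_S ω hkl; have h3 := S_sub_S ω hlj
    rw [incr_union ω hdisj1]
    have : S ω j - S ω i = (S ω k - S ω i) + (S ω l - S ω k) + (S ω j - S ω l) := by abel
    rw [this, h1, h2, h3]; abel
  have hset : (inter i j ∩ inter k l : Set (PathSpace d)) =
      {ω | incr ω (Finset.Ico k l) = 0} ∩ {ω | incr ω (Finset.Ico i k ∪ Finset.Ico l j) = 0} := by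
    ext ω
    simp only [Set.mem_inter_iff, Set.mem_setOf_eq, inter]
    have e1 : S ω k = S ω l ↔ incr ω (Finset.Ico k l) = 0 := by
      rw [← S_sub_S ω hkl, sub_eq_zero, eq_comm]
    have e2 := hdec ω
    constructor
    · rintro ⟨h1, h2⟩
      have h2' := e1.1 h2
      refine ⟨h2', ?_⟩
      have : S ω j - S ω i = 0 := sub_eq_zero.2 h1.symm
      rw [this, h2', add_zero] at e2
      exact e2.symm
    · rintro ⟨h1, h2⟩
      refine ⟨?_, e1.2 h1⟩
      rw [h1, h2, add_zero, sub_eq_zero] at e2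
      exact e2.symm
  rw [hset, real_inter_eq_of_dependsOn hdisj (dependsOn_incr_eq _ 0) (dependsOn_incr_eq _ 0),
    real_incr_eq, real_incr_eq, Nat.card_Ico, Finset.card_union_of_disjoint hdisj1, Nat.card_Ico, Nat.card_Ico]

/-- **Interlaced pairs**: for `i ≤ k ≤ j ≤ l`,
`P(S_i = S_j, S_k = S_l) = Σ_{y} p_{j-k}(y) p_{k-i}(y) p_{l-j}(y)` (sum over the middle increment
`y = S_j - S_k`; the three increments over `[i,k)`, `[k,j)`, `[j,l)` are independent, and
`p(-y) = p(y)`). [folklore] -/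
theorem real_inter_inter_interlaced [NeZero d] {i k j l : ℕ} (hik : i ≤ k) (hkj : k ≤ j) (hjl : j ≤ l) :
    (pathLaw d).real (inter i j ∩ inter k l) =
      ∑ y ∈ box d (j - k), prob d (k - i) y * prob d (j - k) y * prob d (l - j) y := by
  classical
  have hAB : Disjoint (Finset.Ico i k) (Finset.Ico k j) := Finset.Ico_disjoint_Ico_consecutive i k j
  have hBC : Disjoint (Finset.Ico k j) (Finset.Ico j l) := Finset.Ico_disjoint_Ico_consecutive k j l
  have hAC : Disjoint (Finset.Ico i k) (Finset.Ico j l) :=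
    (Finset.Ico_disjoint_Ico_consecutive i k l).mono_right (Finset.Ico_subset_Ico hkj le_rfl)
  have h1 : ∀ ω : PathSpace d, S ω j - S ω i = incr ω (Finset.Ico i k) + incr ω (Finset.Ico k j) := by
    intro ω
    rw [← incr_union ω hAB, Finset.Ico_union_Ico_eq_Ico hik hkj]; exact S_sub_S ω (hik.trans hkj)
  have h2 : ∀ ω : PathSpace d, S ω l - S ω k = incr ω (Finset.Ico k j) + incr ω (Finset.Ico j l) := by
    intro ω
    rw [← incr_union ω hBC, Finset.Ico_union_Ico_eq_Ico hkj hjl]; exact S_sub_S ω (hkj.trans hjl)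
  -- the event as a disjoint union over the value of the middle increment
  have hset : (inter i j ∩ inter k l : Set (PathSpace d)) =
      ⋃ y ∈ box d (j - k), ({ω | incr ω (Finset.Ico k j) = y} ∩ {ω | incr ω (Finset.Ico i k) = -y}) ∩
        {ω | incr ω (Finset.Ico j l) = -y} := by
    ext ω
    simp only [Set.mem_inter_iff, Set.mem_iUnion, Set.mem_setOf_eq, inter, exists_prop]
    have hBbox : incr ω (Finset.Ico k j) ∈ box d (j - k) := by
      have := incr_mem_box ω (Finset.Ico k j)
      rwa [Nat.card_Ico] at this
    constructor
    · rintro ⟨hij', hkl'⟩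
      refine ⟨incr ω (Finset.Ico k j), hBbox, ⟨rfl, ?_⟩, ?_⟩
      · have : incr ω (Finset.Ico i k) + incr ω (Finset.Ico k j) = 0 := by
          rw [← h1, sub_eq_zero]; exact hij'.symm
        exact eq_neg_of_add_eq_zero_left this
      · have : incr ω (Finset.Ico k j) + incr ω (Finset.Ico j l) = 0 := by
          rw [← h2, sub_eq_zero]; exact hkl'.symm
        exact eq_neg_of_add_eq_zero_right this
    · rintro ⟨y, _, ⟨hBy, hAy⟩, hCy⟩
      constructor
      · have : S ω j - S ω i = 0 := by rw [h1, hAy, hBy]; abel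
        exact (sub_eq_zero.1 this).symm
      · have : S ω l - S ω k = 0 := by rw [h2, hBy, hCy]; abel
        exact (sub_eq_zero.1 this).symm
  have hdep2 : ∀ y : Site d, DependsOn (· ∈ ({ω : PathSpace d | incr ω (Finset.Ico k j) = y} ∩
      {ω | incr ω (Finset.Ico i k) = -y})) ((Finset.Ico k j ∪ Finset.Ico i k : Finset ℕ) : Set ℕ) := by
    intro y
    rw [Finset.coe_union]
    exact dependsOn_mem_inter (dependsOn_incr_eq _ _) (dependsOn_incr_eq _ _)
  have hdep3 : ∀ y : Site d, DependsOn (· ∈ ({ω : PathSpace d | incr ω (Finset.Ico k j) = y} ∩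
      {ω | incr ω (Finset.Ico i k) = -y} ∩ {ω | incr ω (Finset.Ico j l) = -y}))
      ((Finset.Ico k j ∪ Finset.Ico i k ∪ Finset.Ico j l : Finset ℕ) : Set ℕ) := by
    intro y
    rw [Finset.coe_union]
    exact dependsOn_mem_inter (hdep2 y) (dependsOn_incr_eq _ _)
  rw [hset, measureReal_def, measure_biUnion_finset]
  · rw [ENNReal.toReal_sum fun y _ => measure_ne_top _ _]
    refine Finset.sum_congr rfl fun y _ => ?_
    rw [← measureReal_def,
      real_inter_eq_of_dependsOn (Finset.disjoint_union_left.2 ⟨hBC, hAC⟩) (hdep2 y) (dependsOn_incr_eq _ _),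
      real_inter_eq_of_dependsOn hAB.symm (dependsOn_incr_eq _ _) (dependsOn_incr_eq _ _),
      real_incr_eq, real_incr_eq, real_incr_eq, Nat.card_Ico, Nat.card_Ico, Nat.card_Ico,
      prob_neg, prob_neg]
    ring
  · intro y _ y' _ hyy'
    refine Set.disjoint_left.2 fun ω hy hy' => hyy' ?_
    exact hy.1.1.symm.trans hy'.1.1
  · intro y _
    exact measurableSet_of_dependsOn (hdep3 y)

end SRW

end Literature.Probability.LatticeModels
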